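import Summits.CriticalPhenomena.Ising3DConformalLimit.Theses.LinkingParityCircles
import Summits.CriticalPhenomena.Ising3DConformalLimit.Theorems.IsingEuclidUpgradeR4NonGaussianFatStep
import Literature.Probability.LatticeModels.CriticalUrsellFourFloor
import Literature.Probability.LatticeModels.PoissonDelaunayIsing
import Literature.Probability.LatticeModels.PlusFreeComparison
import Literature.Probability.LatticeModels.GKSInequalities
import HarnessLib

/-!
# Crux `LinkingParityCircles.SpinRatioMoebius` (stmt-CriticalPhenomena-4530), line `registered` —
# sub-goal `criticalCorr_pos_of_even`: EVEN critical correlators of `ℤ³` are positive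

`0 < ⟨∏ᵢ σ_{yᵢ}⟩⁺_{β_c(3)}` for every even `n` and every `y : Fin n → ℤ³` (repetitions allowed): the spin monomial is the
spin product of the odd-multiplicity support `monomialSupport y` (`σ² = 1`), whose cardinality has the parity of `n`
(`even_card_monomialSupport_iff`, counting fibres modulo `2`), and a spin product of even cardinality has positive
critical plus expectation by iterated GKS II down to pairs (`plusCorr_mul_le`) and `⟨σ_aσ_b⟩_{β_c} > 0`
(`criticalCorr_two_pos'`, Duminil-Copin 2019 Thm. 4.8).  Used by the bridge item 4841 ⇒ `stub_ratioLimitExists`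
(file `…RatioLimitExistsOfCCI.lean`), where ratios of even correlators are manipulated exactly on the lattice.

References: S. Friedli, Y. Velenik (CUP 2017) Thm. 3.20; H. Duminil-Copin (2019) Thm. 4.8.
-/

noncomputable section

namespace Summit.CriticalPhenomena.Ising3DConformalLimit.Cruxes.SpinRatioMoebius.Birth

open Literature.Probability.LatticeModels Filter Set Metric Finset
open Summit.CriticalPhenomena.Ising3DConformalLimit.Cruxes.IsingEuclidUpgradeR4NonGaussian.FreeCovarianceDeltaDichotomy
  (criticalCorr_two_pos')
open scoped Topology symmDiff

/-! ## §A Even critical correlators are positive -/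

/-- The odd-multiplicity support of an `n`-tuple has the parity of `n`. [folklore] -/
theorem even_card_monomialSupport_iff {V : Type*} [DecidableEq V] {n : ℕ} (v : Fin n → V) :
    Even (monomialSupport v).card ↔ Even n := by
  classical
  -- `n = Σ_{p ∈ image} |fiber p|`, and modulo 2 each fiber contributes `1` iff it is odd
  have hn : (Finset.univ : Finset (Fin n)).card = ∑ p ∈ Finset.univ.image v, (Finset.univ.filter fun i => v i = p).card :=
    Finset.card_eq_sum_card_image v Finset.univ
  rw [Finset.card_univ, Fintype.card_fin] at hn
  have hcast : ((n : ℕ) : ZMod 2) = ((monomialSupport v).card : ZMod 2) := by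
    rw [congrArg (fun k : ℕ => (k : ZMod 2)) hn, Nat.cast_sum]
    unfold monomialSupport
    rw [Finset.card_filter, Nat.cast_sum]
    refine Finset.sum_congr rfl fun p _ => ?_
    rcases Nat.even_or_odd (Finset.univ.filter fun i => v i = p).card with he | ho
    · rw [if_neg (Nat.not_odd_iff_even.2 he), (ZMod.natCast_eq_zero_iff_even).2 he, Nat.cast_zero]
    · rw [if_pos ho, (ZMod.natCast_eq_one_iff_odd).2 ho, Nat.cast_one]
  rw [← ZMod.natCast_eq_zero_iff_even, ← ZMod.natCast_eq_zero_iff_even, hcast]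

/-- Even spin products have positive critical plus expectation on `ℤ³` (iterated GKS II down to pairs, and
`⟨σ_aσ_b⟩_{β_c} > 0`). [cite: FriedliVelenik2017, Thm. 3.20, eq. (3.22), p. 109] -/
theorem plusCorr_criticalBeta_pos_of_even_card :
    ∀ (k : ℕ) (B : Finset (Site 3)), B.card = k → Even k → 0 < plusCorr 3 (criticalBeta 3) 0 B := by
  intro k
  induction k using Nat.strong_induction_on with
  | _ k ih =>
    intro B hBk hk
    rcases k with _ | k
    · rw [Finset.card_eq_zero] at hBk
      subst hBk
      rw [plusCorr_empty (criticalBeta_nonneg 3) le_rfl]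
      exact one_pos
    rcases k with _ | k
    · exact absurd hk (by decide)
    -- `B = {a, b} ∪ B'` with `|B'| = k` even
    have hBne : B.Nonempty := Finset.card_pos.1 (by omega)
    obtain ⟨a, ha⟩ := hBne
    have hcard1 : (B.erase a).card = k + 1 := by rw [Finset.card_erase_of_mem ha, hBk]; rfl
    have hBne' : (B.erase a).Nonempty := Finset.card_pos.1 (by omega)
    obtain ⟨b, hb⟩ := hBne'
    have hab : b ≠ a := Finset.ne_of_mem_erase hb
    have hbB : b ∈ B := Finset.mem_of_mem_erase hb
    set B' := (B.erase a).erase b with hB'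
    have hcard' : B'.card = k := by
      rw [hB', Finset.card_erase_of_mem hb, hcard1]; rfl
    have hk' : Even k := by
      rcases hk with ⟨r, hr⟩
      exact ⟨r - 1, by omega⟩
    have hpos' : 0 < plusCorr 3 (criticalBeta 3) 0 B' := ih k (by omega) B' hcard' hk'
    -- `{a, b} ∆ B' = B`
    have haB' : a ∉ B' := by
      rw [hB']; intro h
      exact (Finset.notMem_erase a B) (Finset.mem_of_mem_erase h)
    have hbB' : b ∉ B' := by rw [hB']; exact Finset.notMem_erase b _
    have hdisj : Disjoint ({a, b} : Finset (Site 3)) B' := by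
      rw [Finset.disjoint_insert_left, Finset.disjoint_singleton_left]
      exact ⟨haB', hbB'⟩
    have hsymm : ({a, b} : Finset (Site 3)) ∆ B' = B := by
      rw [Disjoint.symmDiff_eq_sup hdisj, Finset.sup_eq_union]
      ext v
      simp only [Finset.mem_union, Finset.mem_insert, Finset.mem_singleton, hB', Finset.mem_erase]
      constructor
      · rintro ((rfl | rfl) | ⟨_, _, hv⟩)
        · exact ha
        · exact hbB
        · exact hv
      · intro hv
        by_cases hva : v = a
        · exact Or.inl (Or.inl hva)
        by_cases hvb : v = b
        · exact Or.inl (Or.inr hvb)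
        · exact Or.inr ⟨hvb, hva, hv⟩
    -- GKS II and the pair
    have hgks := plusCorr_mul_le (d := 3) (criticalBeta_nonneg 3) le_rfl ({a, b} : Finset (Site 3)) B'
    rw [hsymm] at hgks
    have hpair : 0 < plusCorr 3 (criticalBeta 3) 0 ({a, b} : Finset (Site 3)) := by
      have h2 := criticalCorr_two_pos' a b
      have hinj : Function.Injective (![a, b] : Fin 2 → Site 3) := by
        intro i j hij; fin_cases i <;> fin_cases j
        · rfl
        · exact absurd hij hab.symm
        · exact absurd hij hab
        · rfl
      have h3 : criticalCorr 3 2 ![a, b] = plusCorr 3 (criticalBeta 3) 0 ({a, b} : Finset (Site 3)) := by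
        show plusExpect 3 (criticalBeta 3) 0 (spinMonomial ![a, b]) = plusExpect 3 (criticalBeta 3) 0 (spinProduct {a, b})
        rw [spinMonomial_eq_spinProduct_image' hinj, image_pair_eq]
      rwa [h3] at h2
    exact lt_of_lt_of_le (mul_pos hpair hpos') hgks

/-- **Even critical correlators of `ℤ³` are positive** at every lattice configuration (repetitions allowed). [folklore] -/
theorem criticalCorr_pos_of_even :
    ∀ {n : ℕ}, Even n → ∀ (y : Fin n → Literature.Probability.LatticeModels.Site 3), 0 < Literature.Probability.LatticeModels.criticalCorr 3 n y := by
  intro n hn y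
  classical
  have h : criticalCorr 3 n y = plusCorr 3 (criticalBeta 3) 0 (monomialSupport y) := by
    show plusExpect 3 (criticalBeta 3) 0 (spinMonomial y) = plusExpect 3 (criticalBeta 3) 0 (spinProduct (monomialSupport y))
    congr 1
    funext s
    exact spinMonomial_eq_spinProduct_monomialSupport y s
  rw [h]
  exact plusCorr_criticalBeta_pos_of_even_card _ _ rfl ((even_card_monomialSupport_iff y).2 hn)

end Summit.CriticalPhenomena.Ising3DConformalLimit.Cruxes.SpinRatioMoebius.Birth

end
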